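import Mathlib.MeasureTheory.Integral.IntervalIntegral.AbsolutelyContinuousFun
import HarnessLib

/-!
# Monotonicity from absolute continuity and an a.e. one-sided Dini bound

Analysis/Calculus support file (everything proved). Two elementary real-variable facts used to
integrate differential inequalities that are only available at a.e. time and only as one-sided
(right) lower Dini bounds — the situation of Seis 2022, Lemma 3 ("`D_δ(θ^κ)` is absolutely
continuous and `|d/dt D_δ| ≲ …`") when the solution is a merely measurable-in-time weak solution:

* `absolutelyContinuousOnInterval_of_dist_le` — if `dist (f s) (f t) ≤ P t - P s` for
  `a ≤ s ≤ t ≤ b` with `P` monotone and absolutely continuous (e.g. `P t = ∫ₐᵗ m`, `m ∈ L¹`,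
  `absolutelyContinuousOnInterval_of_dist_le_integral`), then `f` is absolutely continuous;
* `le_of_absolutelyContinuousOnInterval_of_frequently` — if `H` is absolutely continuous on
  `[a, b]` and at a.e. `t ∈ (a, b)`, for every `c > 0`, frequently as `h → 0⁺`,
  `-c h ≤ H (t + h) - H t`, then `H a ≤ H b` (a.e. differentiability of AC functions, the sign of
  the derivative, and the fundamental theorem of calculus for AC functions,
  `AbsolutelyContinuousOnInterval.integral_deriv_eq_sub`).

## References

* C. Seis, Comm. Math. Phys. 399 (2023) (arXiv:2003.08794), Lemma 3. [`Seis2022`]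
* standard real analysis (e.g. Royden, *Real Analysis*, Ch. 6).
-/

noncomputable section

open MeasureTheory Set Filter Topology intervalIntegral

namespace Literature.Analysis.Calculus

variable {X : Type*} [PseudoMetricSpace X]

/-- **Domination of increments by a monotone absolutely continuous function gives absolute
continuity.** [folklore] -/
theorem absolutelyContinuousOnInterval_of_dist_le {f : ℝ → X} {P : ℝ → ℝ} {a b : ℝ}
    (hab : a ≤ b) (hP : AbsolutelyContinuousOnInterval P a b)
    (h : ∀ s t, a ≤ s → s ≤ t → t ≤ b → dist (f s) (f t) ≤ P t - P s) :
    AbsolutelyContinuousOnInterval f a b := by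
  have hst : ∀ s ∈ uIcc a b, ∀ t ∈ uIcc a b, dist (f s) (f t) ≤ dist (P s) (P t) := by
    intro s hs t ht
    rw [uIcc_of_le hab] at hs ht
    rcases le_total s t with hle | hle
    · calc dist (f s) (f t) ≤ P t - P s := h s t hs.1 hle ht.2
        _ ≤ |P s - P t| := by rw [abs_sub_comm]; exact le_abs_self _
        _ = dist (P s) (P t) := (Real.dist_eq _ _).symm
    · calc dist (f s) (f t) = dist (f t) (f s) := dist_comm _ _
        _ ≤ P s - P t := h t s ht.1 hle hs.2
        _ ≤ |P s - P t| := le_abs_self _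
        _ = dist (P s) (P t) := (Real.dist_eq _ _).symm
  rw [absolutelyContinuousOnInterval_iff] at hP ⊢
  intro ε hε
  obtain ⟨δ, hδ, hPδ⟩ := hP ε hε
  refine ⟨δ, hδ, fun E hE hlen => lt_of_le_of_lt (Finset.sum_le_sum fun i hi => ?_) (hPδ E hE hlen)⟩
  exact hst _ (hE.1 i hi).1 _ (hE.1 i hi).2

/-- **Absolute continuity from an integrable modulus**: if `dist (f s) (f t) ≤ ∫ₛᵗ m` for
`a ≤ s ≤ t ≤ b` with `m` integrable on `[a, b]`, then `f` is absolutely continuous on `[a, b]`.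
[folklore] -/
theorem absolutelyContinuousOnInterval_of_dist_le_integral {f : ℝ → X} {m : ℝ → ℝ} {a b : ℝ}
    (hab : a ≤ b) (hm : IntervalIntegrable m volume a b)
    (h : ∀ s t, a ≤ s → s ≤ t → t ≤ b → dist (f s) (f t) ≤ ∫ x in s..t, m x) :
    AbsolutelyContinuousOnInterval f a b := by
  refine absolutelyContinuousOnInterval_of_dist_le hab
    (hm.absolutelyContinuousOnInterval_intervalIntegral (c := a) (by simp)) fun s t has hst htb => ?_
  have hs : IntervalIntegrable m volume a s :=
    hm.mono_set (by rw [uIcc_of_le hab, uIcc_of_le has]; exact Icc_subset_Icc le_rfl (hst.trans htb))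
  have ht : IntervalIntegrable m volume a t :=
    hm.mono_set (by rw [uIcc_of_le hab, uIcc_of_le (has.trans hst)]; exact Icc_subset_Icc le_rfl htb)
  rw [integral_interval_sub_left ht hs]
  exact h s t has hst htb

/-- **Monotonicity from absolute continuity and an a.e. right lower Dini bound.** If `H` is
absolutely continuous on `[a, b]` and for a.e. `t ∈ (a, b)`, for every `c > 0`, frequently as
`h → 0⁺` one has `-c h ≤ H(t + h) - H(t)`, then `H a ≤ H b`. (At a.e. `t` the function is
differentiable, the hypothesis forces `H' t ≥ 0`, and `H b - H a = ∫ₐᵇ H'` for AC functions.)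
[folklore] -/
theorem le_of_absolutelyContinuousOnInterval_of_frequently {H : ℝ → ℝ} {a b : ℝ} (hab : a ≤ b)
    (hH : AbsolutelyContinuousOnInterval H a b)
    (hD : ∀ᵐ t, t ∈ Ioo a b → ∀ c : ℝ, 0 < c →
      ∃ᶠ h in 𝓝[>] (0 : ℝ), -c * h ≤ H (t + h) - H t) :
    H a ≤ H b := by
  have hftc := hH.integral_deriv_eq_sub
  -- the derivative is a.e. nonnegative on `(a, b)`
  have hnn : ∀ᵐ t, t ∈ Ioo a b → 0 ≤ deriv H t := by
    filter_upwards [hH.ae_differentiableAt, hD] with t hdiff hdini ht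
    have htI : t ∈ uIcc a b := by
      rw [uIcc_of_le hab]; exact Ioo_subset_Icc_self ht
    have hder : HasDerivAt H (deriv H t) t := (hdiff htI).hasDerivAt
    have hslope := hder.tendsto_slope_zero_right
    have key : ∀ c : ℝ, 0 < c → -c ≤ deriv H t := by
      intro c hc
      refine ge_of_tendsto_of_frequently hslope ?_
      have hpos : ∀ᶠ h in 𝓝[>] (0 : ℝ), 0 < h := eventually_mem_nhdsWithin
      refine ((hdini ht c hc).and_eventually hpos).mono fun h hh => ?_
      rw [smul_eq_mul, le_inv_mul_iff₀ hh.2]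
      linarith [hh.1]
    by_contra hneg
    have hlt : deriv H t < 0 := lt_of_not_ge hneg
    have := key (-(deriv H t) / 2) (by linarith)
    linarith
  -- endpoints are negligible
  have hnn' : 0 ≤ᵐ[volume.restrict (Icc a b)] deriv H := by
    rw [Filter.EventuallyLE, ae_restrict_iff' measurableSet_Icc]
    have hnull : ∀ᵐ t : ℝ, t ∉ ({a, b} : Set ℝ) :=
      measure_eq_zero_iff_ae_notMem.1 ((Set.toFinite {a, b}).measure_zero volume)
    filter_upwards [hnn, hnull] with t ht hne htI
    have : t ∈ Ioo a b := by
      simp only [mem_insert_iff, mem_singleton_iff, not_or] at hne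
      exact ⟨lt_of_le_of_ne htI.1 (Ne.symm hne.1), lt_of_le_of_ne htI.2 hne.2⟩
    exact ht this
  have hint : 0 ≤ ∫ t in a..b, deriv H t := integral_nonneg_of_ae_restrict hab hnn'
  linarith

end Literature.Analysis.Calculus
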